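import Summits.Ventures.HodgeRepro2.T6N3ToyV
import Summits.Ventures.HodgeRepro2.T6N3ToyR
import Summits.Ventures.HodgeRepro2.T6N3Main2
import Summits.Ventures.HodgeRepro2.T6N2ToyIsoS

/-!
# T6N3Toy2V — the N3 toy on `V` with ℚ-RATIONAL admissible data (N3's share of the joint toy over `NAut3`)

Cell pub-hodge-repro2, Tier 6 (README §10), seat t6-p3 (N3 owner, M2). Proof lane; count-neutral.
The record's admissible Schwartz data are a ℚ-FORM of the `K`-fixed Schwartz data (TIER4 B7(b)–(c) /
Lemma A7.3(b); t6-p5's word, STATUS l. 11271 (2)): closed under ℚ-scaling, ℂ-spanning, NOT closed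
under ℂ-scaling — which is exactly what keeps the periods over admissible choices in a countable set
and so escapes t6-p1's obstruction (`T6N1Obstruction`, p406480; `T6N1Obstruction2`, p406748). A toy
datum that is to carry the N1 displays must therefore take ℚ-rational admissible sets; this file
supplies N3's share of such a joint toy, on the toy N3 datum over an arbitrary complete inner
product space `V` (T6N3ToyV) with t6-p5's explicit-isometry N2 datum at prescribed sets
(`N2ToyIsoS.toyIsoSF`, p406920):
* `ratSet := Set.range ((↑) : ℚ → ℂ)` — the ℚ-rational data of the toy's Schwartz space `𝒮 = ℂ`:
  the ℚ-span of `1` (`ratSet_eq_span_rat_one`), countable, ℂ-spanning (`span_ratSet`), NOT closed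
  under ℂ-scaling (`I_notMem_ratSet`, `ratSet_not_smul_closed`);
* `toyVW V v w` — the toy N3 datum with side A on `v` and side B on `w ∈ ℂ ∙ v` (the shape of t6-p1's
  wiring (S7), STATUS l. 11284: `F_A φa φb = (φa φb) • f_A`, `F_B φc φd = (φc φd) • f_B`; with the
  trivial `G(𝔸_f)` the interface forces `f_B ∈ ℂ ∙ f_A`: `AutSimple` + `AutNonIso` leave one line);
  `toyVW V v v = toyV V v`. All datum-level interface Props, the Rogawski / Howe-duality
  dictionaries (on T6N3ToyR's `toyR` / `toyS`) and both sides' `ellNonzero` are proved on it;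
* the ℚ-rational N2 datum `toyIsoSF F P (toyVW V v w) ratSet ratSet ratSet ratSet` satisfies
  `AdmSpanning`, hence the sentence N2 and N3 share, `AdmGenerating` (and `AdmStable`);
* `toyVW_N3iso₂` — every binder of `N2Datum.N3iso_of_datum₂_gen` discharged: a ℚ-RATIONAL admissible
  quadruple with non-zero pairing; the explicit witness is `(1, 1, 1, 1)` with pairing `⟪w, v⟫ ≠ 0`
  (`toyVW_admData_one`, `toyVW_pairing_one`); and `toyVW_pairing_one_ne_zero_of_ne_zero`, the
  pairing identity behind the carrier field `data_adm'` at the choice `(1, 1, 1, 1)`;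
* the packaged binder lists `toyVW_N3A_main_binders` / `toyVW_N3B_main_binders` /
  `toyVW_N3iso_binders` (T6N3ToyR's pattern) for the lead's joint toy over `NAut3`.
Nothing here is consumed by the M2 theorem: it is a kernel witness (README §10.5(ii)(c)/(d)) that
the N3 binder set of `periodInputN_of_published₆` is jointly satisfiable with ℚ-rational admissible
data on any automorphic space a joint instance may need.

§8(d): uses an L-value-free non-vanishing device: NO.
-/

namespace Summit.Ventures.HodgeRepro2.T6.N3ToyV

open scoped InnerProductSpace
open Summit.Ventures.HodgeRepro2.T6

/-! ## 1. ℚ-rational Schwartz data on the toy's `𝒮 = ℂ` -/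

/-- The ℚ-rational Schwartz data of the toy: the rationals inside `𝒮 = ℂ`. -/
def ratSet : Set ℂ := Set.range ((↑) : ℚ → ℂ)

/-- Every rational is ℚ-rational. -/
lemma ratCast_mem_ratSet (q : ℚ) : (q : ℂ) ∈ ratSet := ⟨q, rfl⟩

/-- `1 ∈ ratSet`. -/
lemma one_mem_ratSet : (1 : ℂ) ∈ ratSet := ⟨1, by simp⟩

/-- `0 ∈ ratSet`. -/
lemma zero_mem_ratSet : (0 : ℂ) ∈ ratSet := ⟨0, by simp⟩

/-- `ratSet` is closed under addition. -/
lemma add_mem_ratSet {x y : ℂ} (hx : x ∈ ratSet) (hy : y ∈ ratSet) : x + y ∈ ratSet := by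
  obtain ⟨p, rfl⟩ := hx
  obtain ⟨q, rfl⟩ := hy
  exact ⟨p + q, by push_cast; rfl⟩

/-- `ratSet` is closed under ℚ-scaling (written as multiplication by a rational). -/
lemma ratCast_mul_mem_ratSet (q : ℚ) {x : ℂ} (hx : x ∈ ratSet) : (q : ℂ) * x ∈ ratSet := by
  obtain ⟨p, rfl⟩ := hx
  exact ⟨q * p, by push_cast; rfl⟩

/-- `ratSet` is closed under negation. -/
lemma neg_mem_ratSet {x : ℂ} (hx : x ∈ ratSet) : -x ∈ ratSet := by
  obtain ⟨p, rfl⟩ := hx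
  exact ⟨-p, by push_cast; rfl⟩

/-- `ratSet` IS the ℚ-rational subspace spanned by `1`: the ℚ-form of the toy's Schwartz space. -/
lemma ratSet_eq_span_rat_one : ratSet = (Submodule.span ℚ ({1} : Set ℂ) : Set ℂ) := by
  ext x
  constructor
  · rintro ⟨q, rfl⟩
    exact Submodule.mem_span_singleton.mpr ⟨q, Rat.smul_one_eq_cast ℂ q⟩
  · intro hx
    obtain ⟨q, rfl⟩ := Submodule.mem_span_singleton.mp hx
    exact ⟨q, (Rat.smul_one_eq_cast ℂ q).symm⟩

/-- `ratSet` is countable (the periods over ℚ-rational data lie in a countable set — t6-p1's `Λ`). -/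
lemma ratSet_countable : ratSet.Countable := Set.countable_range _

/-- `ratSet` is NOT closed under ℂ-scaling: `I = I * 1 ∉ ratSet`. -/
lemma I_notMem_ratSet : Complex.I ∉ ratSet := by
  rintro ⟨q, hq⟩
  have h := congrArg Complex.im hq
  simp at h

/-- `ratSet` is not closed under multiplication by complex scalars (the property that t6-p1's
obstruction needs to FAIL). -/
lemma ratSet_not_smul_closed : ¬ ∀ t x : ℂ, x ∈ ratSet → t * x ∈ ratSet := fun h =>
  I_notMem_ratSet (by simpa using h Complex.I 1 one_mem_ratSet)

/-- `ratSet` ℂ-SPANS the toy's Schwartz space: the ℂ-span of the ℚ-form is everything. -/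
lemma span_ratSet : Submodule.span ℂ ratSet = ⊤ := by
  refine eq_top_iff.mpr fun x _ => ?_
  have hx : x = x • (1 : ℂ) := by rw [smul_eq_mul, mul_one]
  rw [hx]
  exact Submodule.smul_mem _ _ (Submodule.subset_span one_mem_ratSet)

/-! ## 2. The toy datum with side B on a second vector `w ∈ ℂ ∙ v` -/

variable {V : Type} [NormedAddCommGroup V] [InnerProductSpace ℂ V]

/-- A non-zero vector of the line `ℂ ∙ v` spans it. -/
lemma span_singleton_eq_of_mem {v w : V} (hw : w ∈ ℂ ∙ v) (hw0 : w ≠ 0) : (ℂ ∙ w) = ℂ ∙ v := by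
  obtain ⟨a, rfl⟩ := Submodule.mem_span_singleton.mp hw
  have ha : a ≠ 0 := fun h => hw0 (by rw [h, zero_smul])
  exact Submodule.span_singleton_smul_eq (IsUnit.mk0 a ha) v

/-- `⟪w, v⟫ ≠ 0` for `0 ≠ w ∈ ℂ ∙ v`, `v ≠ 0`. -/
lemma inner_ne_zero_of_mem_span {v w : V} (hv : v ≠ 0) (hw : w ∈ ℂ ∙ v) (hw0 : w ≠ 0) :
    ⟪w, v⟫_ℂ ≠ 0 := by
  obtain ⟨a, rfl⟩ := Submodule.mem_span_singleton.mp hw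
  have ha : a ≠ 0 := fun h => hw0 (by rw [h, zero_smul])
  rw [inner_smul_left]
  exact mul_ne_zero ((map_ne_zero _).mpr ha) (inner_self_ne_zero.mpr hv)

variable (V) [CompleteSpace V]

/-- The toy datum on `V` with side A the toy side on `v` and side B the toy side on `w` (the shape of
t6-p1's wiring (S7): `F_A = (φa φb) • f_A`, `F_B = (φc φd) • f_B`); the automorphic representation
is the line `ℂ ∙ v`, and `w ∈ ℂ ∙ v` is a hypothesis of the lemmas that need it. -/
noncomputable abbrev toyVW (v w : V) : N3Datum where
  LG := V
  Gf := Unit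
  ρ _ := LinearIsometry.id
  τiso := ⊤
  Aut := Unit
  aut _ := ℂ ∙ v
  A := sideV V v
  B := sideV V w

variable {V}

/-- `toyVW V v v` is `toyV V v`. -/
lemma toyVW_self (v : V) : toyVW V v v = toyV V v := rfl

/-- `hσ` on `toyVW`: side B's lift `ℂ ∙ w` is side A's lift `ℂ ∙ v`. -/
lemma toyVW_hσ {v w : V} (hw : w ∈ ℂ ∙ v) (hw0 : w ≠ 0) :
    (toyVW V v w).B.σ = (toyVW V v w).A.σ :=
  span_singleton_eq_of_mem hw hw0

/-- (d) for side A: `ellNonzero` on `toyVW` (side A is `sideV V v`). -/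
theorem toyVW_N3A {v : V} (hv : v ≠ 0) (w : V) : (toyVW V v w).ellNonzero (toyVW V v w).A :=
  (toyVW V v w).N3A_of_datum (toyV_KliftCont v) (toyV_Seam v) (toyV_Adjoint v) (toyV_KliftLevel v)
    (toyV_KliftIsotypic v) (toyV_ThetaMemSigma v) (toyV_ThetaTauType v) (toyV_CopiesEquivariant v)
    (toyV_CopiesOrthogonal v) (toyV_CopiesIncl v) (toyV_CopiesTauType v) (toyV_TauTypeDecomposes v)
    (toyV_LevelPartFinite v) (toyV_LevelPartCont v) (toyV_KAverage v) (toyV_ThetaEquivariant v)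
    (toyV_SpanOfFixedVector v) (toyV_CrossCopyOrthogonal v) (toyV_CopyIndependence v)
    (toyV_TensorsSpan v) (toyV_hypI hv) (toyV_hypII v)

/-- (d) for side B: `ellNonzero` on `toyVW` (side B is `sideV V w`). -/
theorem toyVW_N3B (v : V) {w : V} (hw0 : w ≠ 0) : (toyVW V v w).ellNonzero (toyVW V v w).B :=
  (toyVW V v w).N3B_of_datum (toyV_KliftCont w) (toyV_Seam w) (toyV_Adjoint w) (toyV_KliftLevel w)
    (toyV_KliftIsotypic w) (toyV_ThetaMemSigma w) (toyV_ThetaTauType w) (toyV_CopiesEquivariant w)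
    (toyV_CopiesOrthogonal w) (toyV_CopiesIncl w) (toyV_CopiesTauType w) (toyV_TauTypeDecomposes w)
    (toyV_LevelPartFinite w) (toyV_LevelPartCont w) (toyV_KAverage w) (toyV_ThetaEquivariant w)
    (toyV_SpanOfFixedVector w) (toyV_CrossCopyOrthogonal w) (toyV_CopyIndependence w)
    (toyV_TensorsSpan w) (toyV_hypI hw0) (toyV_hypII w)

/-- `ProductsIn20` for side A on `toyVW`: every product `(φa φb) • v` lies in `ℂ ∙ v ⊓ ⊤`. -/
lemma toyVW_ProductsIn20_A (v w : V) : (toyVW V v w).ProductsIn20 (toyVW V v w).A := by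
  refine Submodule.span_le.mpr ?_
  rintro _ ⟨p, rfl⟩
  show prodV V v p.1 p.2 ∈ ⨆ i : Unit, (ℂ ∙ v) ⊓ (⊤ : Submodule ℂ V)
  refine Submodule.mem_iSup_of_mem () ⟨?_, Submodule.mem_top⟩
  rw [prodV_apply]
  exact Submodule.smul_mem _ _ (Submodule.mem_span_singleton_self v)

/-- `ProductsIn20` for side B on `toyVW`: every product `(φc φd) • w` lies in `ℂ ∙ v ⊓ ⊤` when
`w ∈ ℂ ∙ v`. -/
lemma toyVW_ProductsIn20_B {v w : V} (hw : w ∈ ℂ ∙ v) :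
    (toyVW V v w).ProductsIn20 (toyVW V v w).B := by
  refine Submodule.span_le.mpr ?_
  rintro _ ⟨p, rfl⟩
  show prodV V w p.1 p.2 ∈ ⨆ i : Unit, (ℂ ∙ v) ⊓ (⊤ : Submodule ℂ V)
  refine Submodule.mem_iSup_of_mem () ⟨?_, Submodule.mem_top⟩
  rw [prodV_apply]
  exact Submodule.smul_mem _ _ hw

/-- `ProductEquivariant` for side A on `toyVW` (trivial group). -/
lemma toyVW_ProductEquivariant_A (v w : V) :
    (toyVW V v w).ProductEquivariant (toyVW V v w).A :=
  fun _ _ _ => rfl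

/-- `ProductEquivariant` for side B on `toyVW` (trivial group). -/
lemma toyVW_ProductEquivariant_B (v w : V) :
    (toyVW V v w).ProductEquivariant (toyVW V v w).B :=
  fun _ _ _ => rfl

/-- `AutStable` on `toyVW` (`ρ = id`). -/
lemma toyVW_AutStable (v w : V) : (toyVW V v w).AutStable := fun _ _ _ hx => hx

/-- `AutSimple` on `toyVW`: a subspace of the line `ℂ ∙ v` is `⊥` or the line (as on `toyV`). -/
lemma toyVW_AutSimple (v w : V) : (toyVW V v w).AutSimple := toyV_AutSimple v

/-- `AutNonIso` on `toyVW` (one automorphic representation). -/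
lemma toyVW_AutNonIso (v w : V) : (toyVW V v w).AutNonIso (toyVW_AutStable v w) :=
  fun i j hij => absurd (Subsingleton.elim i j) hij

/-- `AutOrthogonal` on `toyVW` (one automorphic representation). -/
lemma toyVW_AutOrthogonal (v w : V) : (toyVW V v w).AutOrthogonal :=
  fun i j hij => absurd (Subsingleton.elim i j) hij

/-- `SigmaIsAut` for side A on `toyVW`: the lift `ℂ ∙ v` is the automorphic representation. -/
lemma toyVW_SigmaIsAut_A (v w : V) : (toyVW V v w).SigmaIsAut (toyVW V v w).A := ⟨(), rfl⟩

/-- `SigmaIsAut` for side B on `toyVW` when `0 ≠ w ∈ ℂ ∙ v`. -/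
lemma toyVW_SigmaIsAut_B {v w : V} (hw : w ∈ ℂ ∙ v) (hw0 : w ≠ 0) :
    (toyVW V v w).SigmaIsAut (toyVW V v w).B :=
  ⟨(), (span_singleton_eq_of_mem hw hw0).symm⟩

/-- (d) for the v1 assembly on `toyVW`: a single pair of products with a non-zero pairing. -/
theorem toyVW_N3iso {v w : V} (hv : v ≠ 0) (hw : w ∈ ℂ ∙ v) (hw0 : w ≠ 0) :
    ∃ (φa : (toyVW V v w).A.Sa) (φb : (toyVW V v w).A.Sb) (φc : (toyVW V v w).B.Sa)
      (φd : (toyVW V v w).B.Sb), ⟪(toyVW V v w).B.F φc φd, (toyVW V v w).A.F φa φb⟫_ℂ ≠ 0 :=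
  (toyVW V v w).N3iso_of_datum (toyVW_AutOrthogonal v w) (toyVW_AutStable v w)
    (toyVW_AutSimple v w) (toyVW_AutNonIso v w) (toyVW_ProductsIn20_A v w)
    (toyVW_ProductEquivariant_A v w) (toyVW_ProductsIn20_B hw) (toyVW_ProductEquivariant_B v w)
    (toyVW_SigmaIsAut_A v w) (toyVW_hσ hw hw0) (toyVW_N3A hv w) (toyVW_N3B v hw0)

/-! ## 3. The pairing on `toyVW` (the identity behind `data_adm'` at the choice `(1, 1, 1, 1)`) -/

/-- The pairing of the products on `toyVW` is the pairing of the unit products scaled by the data: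
`⟪(φc φd) • w, (φa φb) • v⟫ = conj (φc φd) * (φa φb) * ⟪w, v⟫`. -/
lemma toyVW_pairing (v w : V) (φa φb φc φd : ℂ) :
    ⟪(toyVW V v w).B.F φc φd, (toyVW V v w).A.F φa φb⟫_ℂ =
      (starRingEnd ℂ) (φc * φd) * (φa * φb) * ⟪w, v⟫_ℂ := by
  show ⟪prodV V w φc φd, prodV V v φa φb⟫_ℂ = (starRingEnd ℂ) (φc * φd) * (φa * φb) * ⟪w, v⟫_ℂ
  rw [prodV_apply, prodV_apply, inner_smul_left, inner_smul_right]
  ring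

/-- The pairing of the unit products on `toyVW` is `⟪w, v⟫`. -/
lemma toyVW_pairing_one (v w : V) :
    ⟪(toyVW V v w).B.F 1 1, (toyVW V v w).A.F 1 1⟫_ℂ = ⟪w, v⟫_ℂ := by
  rw [toyVW_pairing]
  simp

/-- THE IDENTITY BEHIND `data_adm'` ON THE TOY: if SOME quadruple of data has a non-zero pairing, so
has the unit quadruple `(1, 1, 1, 1)` (the choice `c = (1, 1, 1, 1)` of t6-p1's wiring (S7)). -/
lemma toyVW_pairing_one_ne_zero_of_ne_zero (v w : V) {φa φb φc φd : ℂ}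
    (h : ⟪(toyVW V v w).B.F φc φd, (toyVW V v w).A.F φa φb⟫_ℂ ≠ 0) :
    ⟪(toyVW V v w).B.F 1 1, (toyVW V v w).A.F 1 1⟫_ℂ ≠ 0 := by
  rw [toyVW_pairing_one]
  rw [toyVW_pairing] at h
  exact fun h0 => h (by rw [h0, mul_zero])

/-! ## 4. The ℚ-rational N2 datum on `toyVW` and the sentence N2 and N3 share -/

variable {K : Type*} [Field K] [NumberField K] [NumberField.IsCMField K]

omit [NumberField.IsCMField K] in
/-- An N2 datum over `toyVW` whose four admissible sets are the ℚ-rational data satisfies the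
spanning sentence. -/
theorem admSpanning_of_ratSet {F : FaceSetting K} {P : NDatum F} {v w : V}
    (D : N2Datum F P (toyVW V v w)) (hA : D.admA = ratSet) (hB : D.admB = ratSet)
    (hC : D.admC = ratSet) (hD : D.admD = ratSet) : D.AdmSpanning := by
  refine ⟨?_, ?_, ?_, ?_⟩
  · rw [hA]; exact span_ratSet
  · rw [hB]; exact span_ratSet
  · rw [hC]; exact span_ratSet
  · rw [hD]; exact span_ratSet

/-- t6-p5's explicit-isometry N2 datum on `toyVW` with ℚ-RATIONAL admissible sets satisfies
`AdmSpanning`. -/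
theorem toyIsoSF_rat_admSpanning (F : FaceSetting K) (P : NDatum F) (v w : V) :
    (N2ToyIsoS.toyIsoSF F P (toyVW V v w) ratSet ratSet ratSet ratSet).AdmSpanning :=
  admSpanning_of_ratSet _ rfl rfl rfl rfl

/-- The sentence N2 and N3 share, `AdmGenerating`, on the ℚ-rational datum over `toyVW`. -/
theorem toyIsoSF_rat_admGenerating (F : FaceSetting K) (P : NDatum F) (v w : V) :
    (N2ToyIsoS.toyIsoSF F P (toyVW V v w) ratSet ratSet ratSet ratSet).AdmGenerating :=
  (N2ToyIsoS.toyIsoSF F P (toyVW V v w) ratSet ratSet ratSet ratSet).admGenerating_of_admSpanning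
    (toyIsoSF_rat_admSpanning F P v w)

/-- The stable-route sentence `AdmStable` on the ℚ-rational datum over `toyVW` (the spans are `⊤`). -/
theorem toyIsoSF_rat_admStable (F : FaceSetting K) (P : NDatum F) (v w : V) :
    (N2ToyIsoS.toyIsoSF F P (toyVW V v w) ratSet ratSet ratSet ratSet).AdmStable := by
  obtain ⟨hA, hB, hC, hD⟩ := toyIsoSF_rat_admSpanning F P v w
  refine ⟨fun _ _ _ => ?_, fun _ _ _ => ?_, fun _ _ _ => ?_, fun _ _ _ => ?_⟩
  · rw [hA]; exact Submodule.mem_top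
  · rw [hB]; exact Submodule.mem_top
  · rw [hC]; exact Submodule.mem_top
  · rw [hD]; exact Submodule.mem_top

/-- The unit quadruple `(1, 1, 1, 1)` is ℚ-rational admissible. -/
theorem toyVW_admData_one (F : FaceSetting K) (P : NDatum F) (v w : V) :
    (N2ToyIsoS.toyIsoSF F P (toyVW V v w) ratSet ratSet ratSet ratSet).AdmData (1, 1, 1, 1) :=
  ⟨one_mem_ratSet, one_mem_ratSet, one_mem_ratSet, one_mem_ratSet⟩

/-- (d) for the v2 / v3 isotypic step on `toyVW` with ℚ-RATIONAL admissible data: every binder of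
`N2Datum.N3iso_of_datum₂_gen` discharged — an admissible quadruple with a non-zero pairing. -/
theorem toyVW_N3iso₂ (F : FaceSetting K) (P : NDatum F) {v w : V} (hv : v ≠ 0) (hw : w ∈ ℂ ∙ v)
    (hw0 : w ≠ 0) :
    ∃ (φa : (toyVW V v w).A.Sa) (φb : (toyVW V v w).A.Sb) (φc : (toyVW V v w).B.Sa)
      (φd : (toyVW V v w).B.Sb),
      (N2ToyIsoS.toyIsoSF F P (toyVW V v w) ratSet ratSet ratSet ratSet).AdmData
          (φa, φb, φc, φd) ∧
        ⟪(toyVW V v w).B.F φc φd, (toyVW V v w).A.F φa φb⟫_ℂ ≠ 0 :=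
  (N2ToyIsoS.toyIsoSF F P (toyVW V v w) ratSet ratSet ratSet ratSet).N3iso_of_datum₂_gen
    (toyIsoSF_rat_admGenerating F P v w) (toyVW_AutOrthogonal v w) (toyVW_AutStable v w)
    (toyVW_AutSimple v w) (toyVW_AutNonIso v w) (toyVW_ProductsIn20_A v w)
    (toyVW_ProductEquivariant_A v w) (toyVW_ProductsIn20_B hw) (toyVW_ProductEquivariant_B v w)
    (toyVW_SigmaIsAut_A v w) (toyVW_hσ hw hw0) (toyVW_N3A hv w) (toyVW_N3B v hw0)

/-- The same, with the EXPLICIT witness `(1, 1, 1, 1)` and its pairing `⟪w, v⟫ ≠ 0` (no N3 machinery). -/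
theorem toyVW_N3iso₂_explicit (F : FaceSetting K) (P : NDatum F) {v w : V} (hv : v ≠ 0)
    (hw : w ∈ ℂ ∙ v) (hw0 : w ≠ 0) :
    (N2ToyIsoS.toyIsoSF F P (toyVW V v w) ratSet ratSet ratSet ratSet).AdmData (1, 1, 1, 1) ∧
      ⟪(toyVW V v w).B.F 1 1, (toyVW V v w).A.F 1 1⟫_ℂ ≠ 0 :=
  ⟨toyVW_admData_one F P v w, by
    rw [toyVW_pairing_one]
    exact inner_ne_zero_of_mem_span hv hw hw0⟩

/-! ## 5. The dictionaries and the packaged binder lists on `toyVW` (T6N3ToyR's pattern) -/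

/-- The Rogawski dictionary on `toyVW`: `m ≤ 1` on the toy packets ⟹ `AutNonIso` (outright). -/
theorem toyVW_RogawskiBridge (v w : V) :
    (toyVW V v w).RogawskiBridge N3Toy.toyR (toyVW_AutStable v w) :=
  fun _ => toyVW_AutNonIso v w

/-- The Howe-duality dictionary on `toyVW`, side A, for the constant family of toy shapes. -/
theorem toyVW_HoweDualityBridge_A (v w : V) :
    (toyVW V v w).HoweDualityBridge (fun _ : Unit => N3Toy.toyS) (toyVW V v w).A :=
  fun _ => ⟨toyV_KliftIsotypic v, toyV_ThetaMemSigma v⟩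

/-- The Howe-duality dictionary on `toyVW`, side B. -/
theorem toyVW_HoweDualityBridge_B (v w : V) :
    (toyVW V v w).HoweDualityBridge (fun _ : Unit => N3Toy.toyS) (toyVW V v w).B :=
  fun _ => ⟨toyV_KliftIsotypic w, toyV_ThetaMemSigma w⟩

/-- EVERY binder of `N3A_main` is instantiated on `toyVW`, side A. -/
theorem toyVW_N3A_main_binders (v w : V) :
    (∀ i : Unit, Hyp.GanTakeda2016_Thm1_2 ((fun _ : Unit => N3Toy.toyS) i)) ∧
      (toyVW V v w).HoweDualityBridge (fun _ : Unit => N3Toy.toyS) (toyVW V v w).A ∧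
      (toyVW V v w).A.KliftCont ∧ (toyVW V v w).A.Adjoint ∧ (toyVW V v w).A.KliftLevel ∧
      (toyVW V v w).A.ThetaTauType (toyVW V v w).τiso ∧ (toyVW V v w).A.CopiesEquivariant ∧
      (toyVW V v w).A.CopiesOrthogonal ∧ (toyVW V v w).A.CopiesIncl ∧
      (toyVW V v w).A.CopiesTauType ∧ (toyVW V v w).A.TauTypeDecomposes ∧
      (toyVW V v w).A.LevelPartFinite ∧ (toyVW V v w).A.LevelPartCont ∧ (toyVW V v w).A.KAverage ∧
      (toyVW V v w).A.ThetaEquivariant ∧ (toyVW V v w).A.SpanOfFixedVector ∧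
      (toyVW V v w).A.CrossCopyOrthogonal ∧ (toyVW V v w).A.CopyIndependence ∧
      (toyVW V v w).A.TensorsSpan :=
  ⟨fun _ => N3Toy.toyS_ganTakeda, toyVW_HoweDualityBridge_A v w, toyV_KliftCont v, toyV_Adjoint v,
    toyV_KliftLevel v, toyV_ThetaTauType v, toyV_CopiesEquivariant v, toyV_CopiesOrthogonal v,
    toyV_CopiesIncl v, toyV_CopiesTauType v, toyV_TauTypeDecomposes v, toyV_LevelPartFinite v,
    toyV_LevelPartCont v, toyV_KAverage v, toyV_ThetaEquivariant v, toyV_SpanOfFixedVector v,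
    toyV_CrossCopyOrthogonal v, toyV_CopyIndependence v, toyV_TensorsSpan v⟩

/-- EVERY binder of `N3B_main` is instantiated on `toyVW`, side B. -/
theorem toyVW_N3B_main_binders (v w : V) :
    (∀ i : Unit, Hyp.GanTakeda2016_Thm1_2 ((fun _ : Unit => N3Toy.toyS) i)) ∧
      (toyVW V v w).HoweDualityBridge (fun _ : Unit => N3Toy.toyS) (toyVW V v w).B ∧
      (toyVW V v w).B.KliftCont ∧ (toyVW V v w).B.Adjoint ∧ (toyVW V v w).B.KliftLevel ∧
      (toyVW V v w).B.ThetaTauType (toyVW V v w).τiso ∧ (toyVW V v w).B.CopiesEquivariant ∧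
      (toyVW V v w).B.CopiesOrthogonal ∧ (toyVW V v w).B.CopiesIncl ∧
      (toyVW V v w).B.CopiesTauType ∧ (toyVW V v w).B.TauTypeDecomposes ∧
      (toyVW V v w).B.LevelPartFinite ∧ (toyVW V v w).B.LevelPartCont ∧ (toyVW V v w).B.KAverage ∧
      (toyVW V v w).B.ThetaEquivariant ∧ (toyVW V v w).B.SpanOfFixedVector ∧
      (toyVW V v w).B.CrossCopyOrthogonal ∧ (toyVW V v w).B.CopyIndependence ∧
      (toyVW V v w).B.TensorsSpan :=
  ⟨fun _ => N3Toy.toyS_ganTakeda, toyVW_HoweDualityBridge_B v w, toyV_KliftCont w, toyV_Adjoint w,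
    toyV_KliftLevel w, toyV_ThetaTauType w, toyV_CopiesEquivariant w, toyV_CopiesOrthogonal w,
    toyV_CopiesIncl w, toyV_CopiesTauType w, toyV_TauTypeDecomposes w, toyV_LevelPartFinite w,
    toyV_LevelPartCont w, toyV_KAverage w, toyV_ThetaEquivariant w, toyV_SpanOfFixedVector w,
    toyV_CrossCopyOrthogonal w, toyV_CopyIndependence w, toyV_TensorsSpan w⟩

/-- EVERY binder of `N3iso_main₂` / `N3iso_main₃` other than the sentence `hAdm` is instantiated on
`toyVW` for `0 ≠ w ∈ ℂ ∙ v`: the three Rogawski displays on `toyR`, `hs`, the dictionary, and the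
eight interface Props of N3.L8 with `hσ`. -/
theorem toyVW_N3iso_binders {v w : V} (hw : w ∈ ℂ ∙ v) (hw0 : w ≠ 0) :
    Hyp.Rogawski1990_Sec14_6_Partition N3Toy.toyR ∧ Hyp.Rogawski1990_Thm14_6_4 N3Toy.toyR ∧
      Hyp.Rogawski1990_Thm14_6_5 N3Toy.toyR ∧
      (∀ P' ∈ N3Toy.toyR.Ps, ∀ π, N3Toy.toyR.mem π P' → N3Toy.toyR.m π ≤ 1) ∧
      (toyVW V v w).RogawskiBridge N3Toy.toyR (toyVW_AutStable v w) ∧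
      (toyVW V v w).AutOrthogonal ∧ (toyVW V v w).AutSimple ∧
      (toyVW V v w).ProductsIn20 (toyVW V v w).A ∧
      (toyVW V v w).ProductEquivariant (toyVW V v w).A ∧
      (toyVW V v w).ProductsIn20 (toyVW V v w).B ∧
      (toyVW V v w).ProductEquivariant (toyVW V v w).B ∧
      (toyVW V v w).SigmaIsAut (toyVW V v w).A ∧ (toyVW V v w).B.σ = (toyVW V v w).A.σ :=
  ⟨N3Toy.toyR_partition, N3Toy.toyR_thm14_6_4, N3Toy.toyR_thm14_6_5, N3Toy.toyR_hs,
    toyVW_RogawskiBridge v w, toyVW_AutOrthogonal v w, toyVW_AutSimple v w,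
    toyVW_ProductsIn20_A v w, toyVW_ProductEquivariant_A v w, toyVW_ProductsIn20_B hw,
    toyVW_ProductEquivariant_B v w, toyVW_SigmaIsAut_A v w, toyVW_hσ hw hw0⟩

end Summit.Ventures.HodgeRepro2.T6.N3ToyV
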